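import Summits.HodgeConjecture.HodgeCM.Prior.Perl34_4

/-! PORT of `HodgeCM/Prior/Perl34.lean` (HodgeCMPerL run 81) — part 5: continuation of `Summits.HodgeConjecture.HodgeCM.Prior.Perl34_4` (split at a top-level declaration boundary by port_pkg.py; scope re-opened below; declarations unchanged). -/

-- port_pkg: scope re-opened for this part (file-level context, then the namespace/section stack open at the cut)
namespace HodgeCM.Prior.Perl34File
namespace Perl34
namespace C4a
variable {H HG CG G SK SigIdx SigIdxG : Type*}
variable [NormedAddCommGroup H] [InnerProductSpace ℂ H] [CompleteSpace H]
variable [NormedAddCommGroup HG] [InnerProductSpace ℂ HG] [CompleteSpace HG]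
variable [NormedAddCommGroup CG] [NormedSpace ℂ CG]
variable [Group G] [TopologicalSpace G] [TopologicalSpace SK]
variable (C : IsolationCore H HG CG G SK SigIdx SigIdxG)
/-- **The tier-A Witt lemma, sign-to-sign** (plan C4a(ii), [PerL] ll. 476–478,
341–345): for any two orthogonal (+,−) frames of the same hermitian plane, the
coordinate map a·e₊ + b·e₋ ↦ a·e′₊ + b·e′₋ preserves the form — the two adapted
decompositions are isometric with + matched to + and − to −, which is why e_b
depends only on the sign of the line at b. -/
theorem witt_sign_to_sign {E : Type} [AddCommGroup E] [Module ℂ E] {F : SesqForm E}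
    {ep en ep' en' : E} (h : IsSplitFrame F ep en) (h' : IsSplitFrame F ep' en')
    (a b a' b' : ℂ) :
    F.B (a • ep + b • en) (a' • ep + b' • en)
      = F.B (a • ep' + b • en') (a' • ep' + b' • en') := by
  rw [h.frame_expansion, h'.frame_expansion]

/-! ## The H_occ discharge (lem:arch(c) → the frozen (dagger), ll. 442–443) -/

/-- **Per-side H_occ discharge package** over the M1 point extension.  The composite
field `arch_functional` is the print chain of ll. 513–523 in the shape that leaves
the functional analysis DERIVED: from a nonzero point evaluation of 𝒯_Φ on σ̂ it
produces a MODIFIED Fock–Schwartz index Φ₀ (φ⁰_b ⊗ (⋯) with the fixed data at the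
other places, l. 518) and a point p₀ such that the DERIVED functional
l = `pointFunctional` Φ₀ p₀ (continuity = A#8(iii), proved above) is P_w-averaged
(l ∘ P_w = l, from l(R(t)v) = w_b(t)·l(v) and P = ∫ w̄_b(t) R(t) dt, ll. 520–523 —
S2's A4 `isoProj` content) and still nonzero on σ̂.  Its justification consumes, per
A#9: (i) infinitesimal invariance ⟨XΦ,v⟩ = −⟨Φ,Xv⟩ on Gårding vectors OR topological
cyclicity of φ⁰_b in the smooth κ_b-part (ll. 515–518); (ii) the density of BOTH the
(12)- and (34)-adapted Fock models in the same smooth ω_{W,b} with the same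
κ_b-part, whose bookkeeping brick is `witt_sign_to_sign` above (ll. 341–345,
505–513); and AX3's Fock generation lem:arch(b) — at ι₁ WITH the vacuum ν = (0,0,−2)
of S2's `A3i_kappaPart_iff` + `A3i_nu_delivery` under the named hypothesis
μ_W = μ₁μ₂ (x1 M1 warning: the one place H_occ could be discharged from a false
lemma; the false branch ν = (1,1,−1) = S2's `A3i_false_*` is excluded exactly by
that delivery). -/
structure OccDischarge {C : IsolationCore H HG CG G SK SigIdx SigIdxG}
    (D : TorusData C) (P : PointedCore C) where
  /-- ADDED HYPOTHESIS (M1): the semantic definition of the bare frozen `wOccurs` —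
  "w occurs in σ_∞|_{T(L₀⊗ℝ)}" holds as soon as the w-isotypic projection P_w is
  nonzero somewhere on σ̂ ([PerL] ll. 387–390, 521–523: "Pv ≠ 0: σ̂, hence σ,
  contains a non-zero vector on which T_b acts by w_b").  The frozen field is a bare
  predicate, so C4a proves occurrence in THIS meaning and transfers through this
  bridge. -/
  wOccurs_of_Pw : ∀ i, (∃ v ∈ C.hatσ i, D.Pw v ≠ 0) → D.wOccurs i
  /-- ADDED HYPOTHESIS (M1) + COMPOSITE [A#9(i)(ii), AX3, S2-A4] (ll. 513–523, as
  documented in the structure docstring): the modified-vector functional package. -/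
  arch_functional : ∀ (Φ : SK) (i : SigIdx) (p : P.Pt),
    (∃ v ∈ C.hatσ i, P.evalPt p (C.TΦc Φ v) ≠ 0) →
    ∃ (Φ₀ : SK) (p₀ : P.Pt),
      (∀ v : H, pointFunctional C P Φ₀ p₀ (D.Pw v) = pointFunctional C P Φ₀ p₀ v) ∧
      ∃ v ∈ C.hatσ i, pointFunctional C P Φ₀ p₀ v ≠ 0

namespace OccDischarge

variable {C : IsolationCore H HG CG G SK SigIdx SigIdxG} {D : TorusData C}
variable {P : PointedCore C}

/-- **The H_occ discharge** ([PerL] ll. 442–443 (dagger) from lem:arch(c),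
ll. 488–523): if 𝒯_Φ|_{σ̂} ≠ 0 then w occurs in σ_∞ — verbatim the shape of the
frozen `IsolationSetting.H_occ12/34`.  Proof: L² nonvanishing → sup nonvanishing →
a nonzero point evaluation (M1) → the composite's P_w-averaged functional l with
l(v₀) ≠ 0 on σ̂ → P_w v₀ ≠ 0 (else l(v₀) = l(P_w v₀) = l(0) = 0) → occurrence. -/
theorem H_occ (O : OccDischarge D P) :
    ∀ (Φ : SK) (i : SigIdx), (∃ v ∈ C.hatσ i, C.TΦ Φ v ≠ 0) → D.wOccurs i := by
  intro Φ i h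
  obtain ⟨v, hv, hTv⟩ := h
  obtain ⟨p, hp⟩ := exists_evalPt_ne_zero C P (TΦc_ne_zero C hTv)
  obtain ⟨Φ₀, p₀, hPw, w, hw, hlw⟩ := O.arch_functional Φ i p ⟨v, hv, hp⟩
  apply O.wOccurs_of_Pw i
  refine ⟨w, hw, fun hPwz => hlw ?_⟩
  rw [← hPw w, hPwz, map_zero]

end OccDischarge

/-- **The discharge capstone**: a full `IsolationSetting` assembled from the shared
core, two torus sides, and the C4/C4a packages — H_chars from the two
`CharsDischarge`s (Lemma 4.2(b)), H_occ from the two `OccDischarge`s (Lemma 4.1(c)).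
The w-coherence pin of the x1 cross-read holds by CONSTRUCTION: each package
references its own side's `D.Pw` / `D.wOccurs` / `D.allowed`, so the three symbols
are tied to the same w per side. -/
def mkIsolationSetting (tA tB : TorusData C) {V₁ V₂ : Type} (P : PointedCore C)
    (chA : C4.CharsDischarge tA V₁) (chB : C4.CharsDischarge tB V₂)
    (ocA : OccDischarge tA P) (ocB : OccDischarge tB P) :
    IsolationSetting H HG CG G SK SigIdx SigIdxG where
  core := C
  t12 := tA
  t34 := tB
  H_chars12 := chA.H_chars
  H_chars34 := chB.H_chars
  H_occ12 := ocA.H_occ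
  H_occ34 := ocB.H_occ

end C4a
end Perl34
/-! # SmokeS4 — consistency / non-vacuity certificate for the S4 chain

Byte-identical prefix = C4a_Arch.lean.  A nondegenerate model on which EVERY new
S4 structure (C3a.CharLayer, C3a.AllowedDatum, C4.RallisDatum, C4.CharsDischarge,
C4a.PointedCore, C4a.OccDischarge, C4a.SesqForm frames) is instantiated and every
main theorem exercised — so the field packages are inhabited and the theorems are
not vacuously true.  The isolation model is the one-point model of S3's smoke
(H = HG = CG = ℂ, all index types Unit, 𝒯_Φ = id ≠ 0), rebuilt here since S3's
smoke file is a sibling, not a prefix; the Witt frames include a genuinely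
different second frame (a rational hyperbolic rotation), and the Euler factor is
evaluated at t = 1/2, a = 1 (value 3). -/

namespace Perl34
namespace SmokeS4

local notation "⟪" x ", " y "⟫" => @inner ℂ _ _ x y

/-- span of a set containing 1 is dense in ℂ (helper for the S12 field). -/
theorem closure_span_eq_top_of_one_mem (S : Set ℂ) (h1 : (1 : ℂ) ∈ S) :
    (Submodule.span ℂ S).topologicalClosure = ⊤ := by
  have hspan : Submodule.span ℂ S = ⊤ := by
    rw [Submodule.eq_top_iff']
    intro z
    have hz := Submodule.smul_mem (Submodule.span ℂ S) z (Submodule.subset_span h1)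
    simpa using hz
  rw [hspan]
  exact le_antisymm le_top (Submodule.le_topologicalClosure ⊤)

/-- The one-point isolation core: H = HG = CG = ℂ, G = SK = SigIdx = SigIdxG = Unit,
R trivial, 𝒯_Φ = id ≠ 0, σ̂ = ⊤. -/
noncomputable def core : IsolationCore ℂ ℂ ℂ Unit Unit Unit Unit where
  R := 1
  R_unitary := by
    intro g u v
    rw [MonoidHom.one_apply, one_apply_eq_self,
      one_apply_eq_self]
  omg := fun _ s => s
  TΦc := fun _ => ContinuousLinearMap.id ℂ ℂ
  inclCG := ContinuousLinearMap.id ℂ ℂ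
  hatσ := fun _ => ⊤
  hatσ_closed := by
    intro i
    rw [Submodule.top_coe]
    exact isClosed_univ
  hatσ_invariant := fun _ _ v _ => Submodule.mem_top
  hatσ_ortho := fun i j hij => absurd rfl hij
  hatσ_complete := by
    have h : (⨆ _ : Unit, (⊤ : Submodule ℂ ℂ)) = ⊤ := by simp
    rw [h]
    exact le_antisymm le_top (Submodule.le_topologicalClosure ⊤)
  eσ := fun _ => ContinuousLinearMap.id ℂ ℂ
  eσ_mem := fun _ _ => Submodule.mem_top
  eσ_fix := fun _ _ _ => rfl
  eσ_selfAdjoint := fun _ _ _ => rfl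
  AX9_espectral := fun _ _ _ _ v hv => hv
  hatτ := fun _ => ⊤
  hatτ_closed := by
    intro j
    rw [Submodule.top_coe]
    exact isClosed_univ
  hatτ_complete := by
    have h : (⨆ _ : Unit, (⊤ : Submodule ℂ ℂ)) = ⊤ := by simp
    rw [h]
    exact le_antisymm le_top (Submodule.le_topologicalClosure ⊤)

/-- The one-point torus side: X = TestFn = Unit, allowed ≡ True, ϑ ≡ 1, S₁₂ = ⊤,
P_w = id, wOccurs ≡ True. -/
noncomputable def torus : TorusData core where
  X := Unit
  TestFn := Unit
  allowed := fun _ => True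
  ϑc := fun _ _ => 1
  E := fun _ _ => 1
  S12 := ⊤
  S12_def := by
    symm
    apply closure_span_eq_top_of_one_mem
    exact ⟨(), trivial, (), rfl⟩
  wOccurs := fun _ => True
  Pw := ContinuousLinearMap.id ℂ ℂ
  Pw_idem := ContinuousLinearMap.id_comp _
  Pw_selfAdjoint := fun _ _ => rfl
  AX5b_ϑ_cont := fun _ => continuous_const
  AX12_transl_cont := fun _ _ => continuous_const
  ETransl := fun _ _ f => f
  AX12_E_transl := fun _ _ _ => rfl
  AX12_unfold_lift := fun _ _ _ =>
    Submodule.le_topologicalClosure _ (Submodule.subset_span ⟨(), rfl⟩)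
  AX12_molly := fun _ _ => subset_closure ⟨(), rfl⟩
  AX8_annihilation := by
    intro v hv
    have h := hv () ()
    rw [RCLike.inner_apply, map_one, mul_one] at h
    exact h
  AX9_w_vector := fun M _ _ i _ hne => by
    obtain ⟨v, hv, hv0⟩ := (Submodule.ne_bot_iff _).mp hne
    exact ⟨v, hv, hv0, rfl⟩
/-! ## C3a instances: a two-place model with a non-vacuous sign clause -/

/-- Character layer on B = Bool (two places, ι₁ = `true`), V = Unit. -/
noncomputable def charLayer : C3a.CharLayer Bool Unit where
  Char := Unit
  mExp := fun _ _ => -1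
  locEq := fun _ _ => Set.univ
  AlmostAll := fun s => s = Set.univ
  almostAll_mono := by
    intro s t hst hs
    rw [Set.eq_univ_iff_forall] at hs ⊢
    exact fun v => hst (hs v)
  AX2_rigid := fun χ χ' _ => Subsingleton.elim χ χ'

/-- An allowed datum of type Ψ = (ρ_b everywhere), all exponents −1, all signs −,
ι₁ = `true`, ε_hol = −. -/
noncomputable def allowedDatum :
    C3a.AllowedDatum charLayer (fun _ => false) true where
  mu := ()
  mu_infty := by
    intro b
    refine ⟨-1, 0, ?_, by norm_num, Or.inl ⟨rfl, rfl, rfl⟩⟩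
    show (-1 : ℤ) - 0 = -1
    norm_num
  Con := Unit
  muOf := fun _ => ()
  UnramQuot := fun _ => Set.univ
  AX3_ae := fun _ => rfl
  AX4_howe := fun _ v _ => Set.mem_univ v
  sign := fun _ => false
  epsHol := false
  AX3_sign_iota1 := rfl
  mSign := fun s => if s then 1 else -1
  mSign_flip := by decide
  mSign_unit := by decide
  AX3_sign_forced := by
    intro b hb
    cases b
    · decide
    · exact absurd rfl hb

/-- Lemma 3.3(a) exercised at the instance (both clauses, sign clause non-vacuous). -/
example : C3a.Phiprime (charLayer.mExp (allowedDatum.muOf ()))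
      = C3a.typeSet (fun _ => false) ∧
    (∀ b, b ≠ true →
      allowedDatum.sign b = allowedDatum.mSignInv (C3a.mOf (fun _ => false) b)) ∧
    allowedDatum.sign true = allowedDatum.epsHol :=
  allowedDatum.lem_allowed_a ()

example : allowedDatum.sign false
    = allowedDatum.mSignInv (C3a.mOf (fun _ => false) false) :=
  allowedDatum.C3a_sign false (by decide)

/-! ## C4 instances: the Euler factor and the Rallis chain -/

/-- eulerFactor(1/2, 1) = 3 — a concrete evaluation of the A5 closed form. -/
example : C4.eulerFactor (1 / 2) 1 = 3 := by
  have h : (1 : ℂ) - 1 * ((1 / 2 : ℝ) : ℂ) = (((1 / 2 : ℝ)) : ℂ) := by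
    push_cast
    ring
  rw [C4.eulerFactor, h, Complex.normSq_ofReal]
  norm_num

/-- The A5 HasSum identity exercised at t = 1/2, a = 1. -/
example : HasSum (fun n : ℤ => ((1 / 2 : ℝ) : ℂ) ^ n.natAbs * (1 : ℂ) ^ n)
    ((C4.eulerFactor (1 / 2) 1 : ℝ) : ℂ) :=
  C4.hasSum_eulerFactor (by norm_num) (by norm_num) norm_one

/-- The trivial Rallis datum: S = ∅, all factors 1, nothing split. -/
noncomputable def rallisTrivial : C4.RallisDatum Unit where
  Iloc := fun _ => 1
  S := ∅
  tpar := fun _ => 0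
  apar := fun _ => 1
  IsSplit := fun _ => False
  c := 1
  c_pos := one_pos
  innerSelf := 1
  tail := 1
  AX7_factor := by simp
  AX7_tail := hasProd_one
  tpar_nonneg := fun _ => le_refl 0
  tpar_le := fun _ => by norm_num
  apar_norm := fun _ => norm_one
  A11_summable := summable_zero
  AX7_split_val := fun _ _ hs => hs.elim
  AX7_nonsplit_val := fun _ _ _ => rfl
  ram_pos := fun v hv => absurd hv (by simp)

example : 0 < rallisTrivial.innerSelf := rallisTrivial.innerSelf_pos

/-- The H_chars discharge package on the one-point model. -/
noncomputable def charsD : C4.CharsDischarge torus Unit where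
  rallis := fun _ => rallisTrivial
  θvec := fun _ => 1
  innerSelf_eq := fun _ => by simp [rallisTrivial]
  allowed_of_theta := fun _ _ => True.intro

/-! ## C4a instances: points, the occurrence package, and the capstone -/

/-- The M1 point extension on the one-point model: Pt = Unit, evaluation = id. -/
noncomputable def pointed : C4a.PointedCore core where
  Pt := Unit
  evalPt := fun _ => ContinuousLinearMap.id ℂ ℂ
  evalPt_sep := fun _ h => h ()

/-- The H_occ discharge package on the one-point model. -/
theorem occD : C4a.OccDischarge torus pointed where
  wOccurs_of_Pw := fun _ _ => True.intro
  arch_functional := fun _ _ _ h => ⟨(), (), fun _ => rfl, h⟩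

/-- **The capstone exercised**: a full `IsolationSetting` assembled from the S4
discharge packages. -/
noncomputable def setting : IsolationSetting ℂ ℂ ℂ Unit Unit Unit Unit :=
  C4a.mkIsolationSetting core torus torus pointed charsD charsD occD occD

example : ∀ χ : setting.t12.X, setting.t12.allowed χ := setting.H_chars12

/-- H_occ of the assembled setting, exercised at the nonzero vector 1 (𝒯_Φ = id). -/
example : setting.t12.wOccurs () :=
  setting.H_occ12 () () ⟨1, Submodule.mem_top, one_ne_zero⟩

/-- S₁₂ of the model is ⊤ ≠ ⊥ (the setting is nondegenerate). -/
example : setting.t12.S12 ≠ ⊥ := by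
  show (⊤ : Submodule ℂ ℂ) ≠ ⊥
  simp

/-! ## Witt frames: the standard frame and a rational hyperbolic rotation -/

/-- The standard (1,1) hermitian form on ℂ²: B(x,y) = x₀ȳ₀ − x₁ȳ₁. -/
noncomputable def stdForm : C4a.SesqForm (Fin 2 → ℂ) where
  B := fun x y => x 0 * (starRingEnd ℂ) (y 0) - x 1 * (starRingEnd ℂ) (y 1)
  add_left := by
    intro x y z
    simp only [Pi.add_apply]
    ring
  smul_left := by
    intro c x y
    simp only [Pi.smul_apply, smul_eq_mul]
    ring
  conj_symm := by
    intro x y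
    simp only [map_sub, map_mul, Complex.conj_conj]
    ring

/-- (no docstring in the 2001 source) -/
noncomputable def fp : Fin 2 → ℂ := ![1, 0]
/-- (no docstring in the 2001 source) -/
noncomputable def fn : Fin 2 → ℂ := ![0, 1]
/-- (no docstring in the 2001 source) -/
noncomputable def gp : Fin 2 → ℂ := ![((5 / 4 : ℝ) : ℂ), ((3 / 4 : ℝ) : ℂ)]
/-- (no docstring in the 2001 source) -/
noncomputable def gn : Fin 2 → ℂ := ![((3 / 4 : ℝ) : ℂ), ((5 / 4 : ℝ) : ℂ)]

/-- (no docstring in the 2001 source) -/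
theorem frame_std : C4a.IsSplitFrame stdForm fp fn := by
  refine ⟨?_, ?_, ?_⟩ <;> simp [stdForm, fp, fn]

/-- A genuinely different orthogonal (+,−) frame: the hyperbolic rotation
(5/4, 3/4), (3/4, 5/4) — Gram diag(1, −1), off-diagonal 0. -/
theorem frame_rot : C4a.IsSplitFrame stdForm gp gn := by
  refine ⟨?_, ?_, ?_⟩
  · show ((5 / 4 : ℝ) : ℂ) * (starRingEnd ℂ) ((5 / 4 : ℝ) : ℂ)
        - ((3 / 4 : ℝ) : ℂ) * (starRingEnd ℂ) ((3 / 4 : ℝ) : ℂ) = 1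
    rw [Complex.conj_ofReal, Complex.conj_ofReal]
    push_cast
    norm_num
  · show ((3 / 4 : ℝ) : ℂ) * (starRingEnd ℂ) ((3 / 4 : ℝ) : ℂ)
        - ((5 / 4 : ℝ) : ℂ) * (starRingEnd ℂ) ((5 / 4 : ℝ) : ℂ) = -1
    rw [Complex.conj_ofReal, Complex.conj_ofReal]
    push_cast
    norm_num
  · show ((5 / 4 : ℝ) : ℂ) * (starRingEnd ℂ) ((3 / 4 : ℝ) : ℂ)
        - ((3 / 4 : ℝ) : ℂ) * (starRingEnd ℂ) ((5 / 4 : ℝ) : ℂ) = 0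
    rw [Complex.conj_ofReal, Complex.conj_ofReal]
    ring

/-- The Witt sign-to-sign lemma exercised on two genuinely different frames. -/
example (a b a' b' : ℂ) :
    stdForm.B (a • fp + b • fn) (a' • fp + b' • fn)
      = stdForm.B (a • gp + b • gn) (a' • gp + b' • gn) :=
  C4a.witt_sign_to_sign frame_std frame_rot a b a' b'

/-- Frame linear independence exercised. -/
example {a b : ℂ} (h : a • gp + b • gn = 0) : a = 0 ∧ b = 0 :=
  frame_rot.coeff_eq_zero h

end SmokeS4
end Perl34

end HodgeCM.Prior.Perl34File
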